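import Mathlib
import Summits.MatrixMultiplication.MatrixMultiplication.Theses.FidelityWitnesses
import Summits.MatrixMultiplication.MatrixMultiplication.Theorems.FidelityWitnessesSevenEighthsLawStubSliceElimination

/-!
# `FidelityWitnesses.SixEighthsAtFive` on the hyperplane strata (where the supremum `6` lives)

Support file for item `stmt-MatrixMultiplication-14040` of route `MatrixMultiplication/FidelityWitnesses`
(`SixEighthsAtFive`, `M(2,5) ≤ 6`: `|⟨S, ⟨2,2,2⟩⟩|² ≤ 6 · ‖S‖²` for every tensor `S` of rank `≤ 5` in the `2 × 2` format;
slots `S a b c`, `a = (κ,ν)` output, `b = (κ,μ)`, `c = (μ,ν)`).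

THE HYPERPLANE STRATA.  Say that a tensor `S` is ANNIHILATED IN A SLOT by a non-zero functional
`n : Fin 2 × Fin 2 → ℂ` if `Σ_b n b · S a b c = 0` for all `a, c` (middle slot; likewise for the output slot `a` and
the slot `c`) — equivalently, all factors of that slot in any decomposition of `S` lie in the hyperplane `ker n` of
`ℂ^{2×2}`.  For such `S` — of ANY rank — `|⟨S,T⟩|² ≤ 6 ‖S‖²` (`sixEighthsAtFive_of_annihilated_b/a/c`), with the
constant `6 = ‖T‖² − 2` coming from the fact that every slot-marginal of `T = ⟨2,2,2⟩` is `2 · id` (each matrix entry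
`x_{κμ}` occurs in exactly two of the eight unit products).  Proof: weighted Cauchy–Schwarz.  For the pair `(a,c)` only
`b₀ = (a.1, c.1)` meets the support of `T`; the relation `n b₀ S_{a b₀ c} = −Σ_{b ≠ b₀} n b S_{a b c}` gives
`|S_{a b₀ c}|² ≤ (1 − ρ b₀) Σ_b |S_{a b c}|²` with `ρ b = |n b|²/‖n‖²`, and `Σ_{(a,c)} (1 − ρ (a.1,c.1)) = 8 − 2 = 6`.

WHY THIS MATTERS FOR THE ITEM.  Every charted maximising family of the `(2,5)` problem lies in (or converges to) these
strata: Bini's honest rank-5 family `m·M^red + C₂` (Landsberg 2017 (2.1.2); `bini5S` in the crux disproof file) has ALL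
its `x`-factors in the hyperplane `x₂₂ = 0`, so `sixEighthsAtFive_biniStratum` below proves the item's inequality on the
whole Bini stratum (every `m`, every output factor, any number of products) — the family along which the bound `6` is
approached (`36 m²/(6 m² + 4) ↑ 6`).  Numerically (this seat, NOTES.md) ALL near-maximisers of the honest problem have
both their `x`- and `y`-configurations degenerating to a hyperplane; the open content of the item is therefore a
"no interior ridge" statement: tensors of rank `≤ 5` whose factors span `ℂ^{2×2}` in every slot stay below `6`.

Contents: `sixEighthsAtFive_annihilated_entry_sq_le` (the one-term bound), `sixEighthsAtFive_of_annihilated_b`, `…_a`, `…_c`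
(the three slots), `sixEighthsAtFive_of_triads_annihilated_b` (sums of triads with middle factors in a hyperplane,
any number of triads) and `sixEighthsAtFive_biniStratum` (middle factors with a vanishing entry).
Mathlib + the tree (`matMulTensor`, `triad`, `SevenEighthsLaw.slice_sum_matMulTensor`, `SevenEighthsLaw.norm_sum_mul_sq_le`).
-/

set_option linter.dupNamespace false

namespace Summit.MatrixMultiplication.MatrixMultiplication.Theorems

open scoped BigOperators ComplexConjugate
open Literature.Computability.AlgebraicComplexity

/-! ## The one-term bound from a linear relation -/

/-- **One-term bound.** If `Σ_b n b · s b = 0` then for every `b₀`: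
`‖s b₀‖² · ‖n‖² ≤ (‖n‖² − ‖n b₀‖²) · Σ_b ‖s b‖²` (Cauchy–Schwarz on `n b₀ s b₀ = −Σ_{b ≠ b₀} n b s b`). [folklore] -/
theorem sixEighthsAtFive_annihilated_entry_sq_le {ι : Type*} [Fintype ι] [DecidableEq ι] (n s : ι → ℂ)
    (h : ∑ b, n b * s b = 0) (b₀ : ι) :
    ‖s b₀‖ ^ 2 * ∑ b, ‖n b‖ ^ 2 ≤ ((∑ b, ‖n b‖ ^ 2) - ‖n b₀‖ ^ 2) * ∑ b, ‖s b‖ ^ 2 := by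
  -- zero out the `b₀` entries
  set n' : ι → ℂ := fun b => if b = b₀ then 0 else n b with hn'
  set s' : ι → ℂ := fun b => if b = b₀ then 0 else s b with hs'
  have hsum : ∑ b, n' b * s' b = -(n b₀ * s b₀) := by
    have h1 : ∑ b, n' b * s' b = ∑ b, (n b * s b - if b = b₀ then n b₀ * s b₀ else 0) := by
      refine Finset.sum_congr rfl fun b _ => ?_
      by_cases hb : b = b₀
      · subst hb; simp [hn', hs']
      · simp [hn', hs', hb]
    rw [h1, Finset.sum_sub_distrib, h, Finset.sum_ite_eq' Finset.univ b₀]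
    simp
  have hN : ∑ b, ‖n' b‖ ^ 2 = (∑ b, ‖n b‖ ^ 2) - ‖n b₀‖ ^ 2 := by
    have h1 : ∑ b, ‖n' b‖ ^ 2 = ∑ b, (‖n b‖ ^ 2 - if b = b₀ then ‖n b₀‖ ^ 2 else 0) := by
      refine Finset.sum_congr rfl fun b _ => ?_
      by_cases hb : b = b₀
      · subst hb; simp [hn']
      · simp [hn', hb]
    rw [h1, Finset.sum_sub_distrib, Finset.sum_ite_eq' Finset.univ b₀]
    simp
  have hS : ∑ b, ‖s' b‖ ^ 2 = (∑ b, ‖s b‖ ^ 2) - ‖s b₀‖ ^ 2 := by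
    have h1 : ∑ b, ‖s' b‖ ^ 2 = ∑ b, (‖s b‖ ^ 2 - if b = b₀ then ‖s b₀‖ ^ 2 else 0) := by
      refine Finset.sum_congr rfl fun b _ => ?_
      by_cases hb : b = b₀
      · subst hb; simp [hs']
      · simp [hs', hb]
    rw [h1, Finset.sum_sub_distrib, Finset.sum_ite_eq' Finset.univ b₀]
    simp
  have hCS := SevenEighthsLaw.norm_sum_mul_sq_le Finset.univ n' s'
  rw [hsum, norm_neg, norm_mul, mul_pow, hN, hS] at hCS
  -- `‖n b₀‖² ‖s b₀‖² ≤ (N − ‖n b₀‖²)(σ − ‖s b₀‖²)`; expand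
  have hNn : ‖n b₀‖ ^ 2 ≤ ∑ b, ‖n b‖ ^ 2 :=
    Finset.single_le_sum (f := fun b => ‖n b‖ ^ 2) (fun b _ => sq_nonneg _) (Finset.mem_univ b₀)
  have hSs : ‖s b₀‖ ^ 2 ≤ ∑ b, ‖s b‖ ^ 2 :=
    Finset.single_le_sum (f := fun b => ‖s b‖ ^ 2) (fun b _ => sq_nonneg _) (Finset.mem_univ b₀)
  nlinarith [hCS, hNn, hSs, sq_nonneg ‖n b₀‖, sq_nonneg ‖s b₀‖]

/-- The one-term bound in ratio form: `‖s b₀‖² ≤ (1 − ‖n b₀‖²/‖n‖²) · Σ_b ‖s b‖²` for `n ≠ 0`. [folklore] -/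
theorem sixEighthsAtFive_annihilated_entry_sq_le' {ι : Type*} [Fintype ι] [DecidableEq ι] (n s : ι → ℂ)
    (hn : 0 < ∑ b, ‖n b‖ ^ 2) (h : ∑ b, n b * s b = 0) (b₀ : ι) :
    ‖s b₀‖ ^ 2 ≤ (1 - ‖n b₀‖ ^ 2 / ∑ b, ‖n b‖ ^ 2) * ∑ b, ‖s b‖ ^ 2 := by
  have key := sixEighthsAtFive_annihilated_entry_sq_le n s h b₀
  rw [← le_div_iff₀ hn] at key
  calc ‖s b₀‖ ^ 2 ≤ ((∑ b, ‖n b‖ ^ 2) - ‖n b₀‖ ^ 2) * (∑ b, ‖s b‖ ^ 2) / ∑ b, ‖n b‖ ^ 2 := key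
    _ = (1 - ‖n b₀‖ ^ 2 / ∑ b, ‖n b‖ ^ 2) * ∑ b, ‖s b‖ ^ 2 := by
        field_simp

/-! ## The weights: every slot-marginal of `⟨2,2,2⟩` is `2 · id` -/

/-- `Σ_{a} Σ_{m} ρ (a.1, m) = 2 Σ_b ρ b` over `a : Fin 2 × Fin 2`, `m : Fin 2`. [folklore] -/
theorem sixEighthsAtFive_sum_weight_b (ρ : Fin 2 × Fin 2 → ℝ) :
    ∑ a : Fin 2 × Fin 2, ∑ m : Fin 2, ρ (a.1, m) = 2 * ∑ b : Fin 2 × Fin 2, ρ b := by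
  simp only [Fintype.sum_prod_type, Fin.sum_univ_two, Fin.isValue]
  ring

/-- `Σ_{b} Σ_{ν} ρ (b.1, ν) = 2 Σ_a ρ a` and `Σ_b Σ_ν ρ (b.2, ν) = 2 Σ_c ρ c`. [folklore] -/
theorem sixEighthsAtFive_sum_weight_ac (ρ : Fin 2 × Fin 2 → ℝ) :
    (∑ b : Fin 2 × Fin 2, ∑ ν : Fin 2, ρ (b.1, ν) = 2 * ∑ a : Fin 2 × Fin 2, ρ a) ∧
    (∑ b : Fin 2 × Fin 2, ∑ ν : Fin 2, ρ (b.2, ν) = 2 * ∑ c : Fin 2 × Fin 2, ρ c) := by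
  constructor <;>
  · simp only [Fintype.sum_prod_type, Fin.sum_univ_two, Fin.isValue]
    ring

/-- The pairing with `⟨2,2,2⟩` regrouped along the middle/third slots:
`Σ_{a,b,c} S a b c T a b c = Σ_b Σ_ν S (b.1,ν) b (b.2,ν)`. [folklore] -/
theorem sixEighthsAtFive_pairing_regroup_bc (S : (Fin 2 × Fin 2) → (Fin 2 × Fin 2) → (Fin 2 × Fin 2) → ℂ) :
    ∑ a, ∑ b, ∑ c, S a b c * matMulTensor ℂ 2 2 2 a b c =
      ∑ b : Fin 2 × Fin 2, ∑ ν : Fin 2, S (b.1, ν) b (b.2, ν) := by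
  simp only [matMulTensor, Fintype.sum_prod_type, Fin.sum_univ_two, Fin.isValue]
  simp
  ring

/-! ## Middle slot -/

/-- **`SixEighthsAtFive` on the middle-slot hyperplane stratum.** If a non-zero functional `n` annihilates the
middle slot of `S` (`Σ_b n b S a b c = 0` for all `a, c` — all `x`-factors of `S` lie in the hyperplane `ker n`),
then `|⟨S, ⟨2,2,2⟩⟩|² ≤ 6 ‖S‖²`, for `S` of ANY rank. [folklore] -/
theorem sixEighthsAtFive_of_annihilated_b
    (S : (Fin 2 × Fin 2) → (Fin 2 × Fin 2) → (Fin 2 × Fin 2) → ℂ) (n : Fin 2 × Fin 2 → ℂ)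
    (hn : n ≠ 0) (hS : ∀ a c, ∑ b, n b * S a b c = 0) :
    ‖∑ a, ∑ b, ∑ c, S a b c * matMulTensor ℂ 2 2 2 a b c‖ ^ 2 ≤ 6 * ∑ a, ∑ b, ∑ c, ‖S a b c‖ ^ 2 := by
  classical
  have hN : 0 < ∑ b, ‖n b‖ ^ 2 := by
    obtain ⟨b, hb⟩ : ∃ b, n b ≠ 0 := by
      by_contra hcon
      push Not at hcon
      exact hn (funext hcon)
    exact lt_of_lt_of_le (by positivity : (0 : ℝ) < ‖n b‖ ^ 2)
      (Finset.single_le_sum (f := fun b => ‖n b‖ ^ 2) (fun b _ => sq_nonneg _) (Finset.mem_univ b))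
  set ρ : Fin 2 × Fin 2 → ℝ := fun b => ‖n b‖ ^ 2 / ∑ b, ‖n b‖ ^ 2 with hρ
  have hρsum : ∑ b, ρ b = 1 := by
    rw [hρ, ← Finset.sum_div, div_self hN.ne']
  have hρle : ∀ b, ρ b ≤ 1 := fun b => by
    rw [hρ, div_le_one hN]
    exact Finset.single_le_sum (f := fun b => ‖n b‖ ^ 2) (fun b _ => sq_nonneg _) (Finset.mem_univ b)
  -- regroup the pairing: `Σ_a Σ_m S a (a.1,m) (m,a.2)`
  have hpair : ∑ a, ∑ b, ∑ c, S a b c * matMulTensor ℂ 2 2 2 a b c =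
      ∑ a : Fin 2 × Fin 2, ∑ m : Fin 2, S a (a.1, m) (m, a.2) :=
    Finset.sum_congr rfl fun a _ => SevenEighthsLaw.slice_sum_matMulTensor (S a) a
  -- one-term bounds
  have hterm : ∀ (a : Fin 2 × Fin 2) (m : Fin 2),
      ‖S a (a.1, m) (m, a.2)‖ ^ 2 ≤ (1 - ρ (a.1, m)) * ∑ b, ‖S a b (m, a.2)‖ ^ 2 :=
    fun a m => sixEighthsAtFive_annihilated_entry_sq_le' n (fun b => S a b (m, a.2)) hN (hS a (m, a.2)) (a.1, m)
  -- weighted Cauchy–Schwarz over the index set `(a, m)`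
  have hCS : (∑ p : (Fin 2 × Fin 2) × Fin 2, ‖S p.1 (p.1.1, p.2) (p.2, p.1.2)‖) ^ 2 ≤
      (∑ p : (Fin 2 × Fin 2) × Fin 2, (1 - ρ (p.1.1, p.2))) *
        ∑ p : (Fin 2 × Fin 2) × Fin 2, ∑ b, ‖S p.1 b (p.2, p.1.2)‖ ^ 2 :=
    Finset.sum_sq_le_sum_mul_sum_of_sq_le_mul Finset.univ
      (fun p _ => sub_nonneg.mpr (hρle _)) (fun p _ => by positivity) (fun p _ => hterm p.1 p.2)
  have hW : ∑ p : (Fin 2 × Fin 2) × Fin 2, (1 - ρ (p.1.1, p.2)) = 6 := by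
    have h1 : ∑ a : Fin 2 × Fin 2, ∑ m : Fin 2, ρ (a.1, m) = 2 := by
      rw [sixEighthsAtFive_sum_weight_b ρ, hρsum]; ring
    simp only [Fintype.sum_prod_type, Fin.sum_univ_two, Fin.isValue] at h1 ⊢
    linarith
  have hB : ∑ p : (Fin 2 × Fin 2) × Fin 2, ∑ b, ‖S p.1 b (p.2, p.1.2)‖ ^ 2 ≤
      ∑ a, ∑ b, ∑ c, ‖S a b c‖ ^ 2 := by
    rw [Fintype.sum_prod_type]
    refine Finset.sum_le_sum fun a _ => ?_
    rw [Finset.sum_comm]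
    refine Finset.sum_le_sum fun b _ => ?_
    -- `Σ_m ‖S a b (m, a.2)‖² ≤ Σ_c ‖S a b c‖²`
    rw [Fintype.sum_prod_type (f := fun c : Fin 2 × Fin 2 => ‖S a b c‖ ^ 2)]
    exact Finset.sum_le_sum fun m _ =>
      Finset.single_le_sum (f := fun ν => ‖S a b (m, ν)‖ ^ 2) (fun ν _ => sq_nonneg _)
        (Finset.mem_univ a.2)
  calc ‖∑ a, ∑ b, ∑ c, S a b c * matMulTensor ℂ 2 2 2 a b c‖ ^ 2
      = ‖∑ p : (Fin 2 × Fin 2) × Fin 2, S p.1 (p.1.1, p.2) (p.2, p.1.2)‖ ^ 2 := by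
        rw [hpair, Fintype.sum_prod_type (f := fun p : (Fin 2 × Fin 2) × Fin 2 =>
          S p.1 (p.1.1, p.2) (p.2, p.1.2))]
    _ ≤ (∑ p : (Fin 2 × Fin 2) × Fin 2, ‖S p.1 (p.1.1, p.2) (p.2, p.1.2)‖) ^ 2 :=
        pow_le_pow_left₀ (norm_nonneg _) (norm_sum_le _ _) 2
    _ ≤ 6 * ∑ a, ∑ b, ∑ c, ‖S a b c‖ ^ 2 := by
        rw [hW] at hCS
        exact hCS.trans (mul_le_mul_of_nonneg_left hB (by norm_num))

/-! ## Output slot and third slot -/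

/-- **`SixEighthsAtFive` on the output-slot hyperplane stratum**: if a non-zero functional annihilates the output
slot `a` of `S` (`Σ_a n a S a b c = 0` for all `b, c`), then `|⟨S, ⟨2,2,2⟩⟩|² ≤ 6 ‖S‖²` (any rank). [folklore] -/
theorem sixEighthsAtFive_of_annihilated_a
    (S : (Fin 2 × Fin 2) → (Fin 2 × Fin 2) → (Fin 2 × Fin 2) → ℂ) (n : Fin 2 × Fin 2 → ℂ)
    (hn : n ≠ 0) (hS : ∀ b c, ∑ a, n a * S a b c = 0) :
    ‖∑ a, ∑ b, ∑ c, S a b c * matMulTensor ℂ 2 2 2 a b c‖ ^ 2 ≤ 6 * ∑ a, ∑ b, ∑ c, ‖S a b c‖ ^ 2 := by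
  classical
  have hN : 0 < ∑ b, ‖n b‖ ^ 2 := by
    obtain ⟨b, hb⟩ : ∃ b, n b ≠ 0 := by
      by_contra hcon
      push Not at hcon
      exact hn (funext hcon)
    exact lt_of_lt_of_le (by positivity : (0 : ℝ) < ‖n b‖ ^ 2)
      (Finset.single_le_sum (f := fun b => ‖n b‖ ^ 2) (fun b _ => sq_nonneg _) (Finset.mem_univ b))
  set ρ : Fin 2 × Fin 2 → ℝ := fun b => ‖n b‖ ^ 2 / ∑ b, ‖n b‖ ^ 2 with hρ
  have hρsum : ∑ b, ρ b = 1 := by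
    rw [hρ, ← Finset.sum_div, div_self hN.ne']
  have hρle : ∀ b, ρ b ≤ 1 := fun b => by
    rw [hρ, div_le_one hN]
    exact Finset.single_le_sum (f := fun b => ‖n b‖ ^ 2) (fun b _ => sq_nonneg _) (Finset.mem_univ b)
  have hterm : ∀ (b : Fin 2 × Fin 2) (ν : Fin 2),
      ‖S (b.1, ν) b (b.2, ν)‖ ^ 2 ≤ (1 - ρ (b.1, ν)) * ∑ a, ‖S a b (b.2, ν)‖ ^ 2 :=
    fun b ν => sixEighthsAtFive_annihilated_entry_sq_le' n (fun a => S a b (b.2, ν)) hN (hS b (b.2, ν)) (b.1, ν)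
  have hCS : (∑ p : (Fin 2 × Fin 2) × Fin 2, ‖S (p.1.1, p.2) p.1 (p.1.2, p.2)‖) ^ 2 ≤
      (∑ p : (Fin 2 × Fin 2) × Fin 2, (1 - ρ (p.1.1, p.2))) *
        ∑ p : (Fin 2 × Fin 2) × Fin 2, ∑ a, ‖S a p.1 (p.1.2, p.2)‖ ^ 2 :=
    Finset.sum_sq_le_sum_mul_sum_of_sq_le_mul Finset.univ
      (fun p _ => sub_nonneg.mpr (hρle _)) (fun p _ => by positivity) (fun p _ => hterm p.1 p.2)
  have hW : ∑ p : (Fin 2 × Fin 2) × Fin 2, (1 - ρ (p.1.1, p.2)) = 6 := by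
    have h1 : ∑ b : Fin 2 × Fin 2, ∑ ν : Fin 2, ρ (b.1, ν) = 2 := by
      rw [(sixEighthsAtFive_sum_weight_ac ρ).1, hρsum]; ring
    simp only [Fintype.sum_prod_type, Fin.sum_univ_two, Fin.isValue] at h1 ⊢
    linarith
  have hB : ∑ p : (Fin 2 × Fin 2) × Fin 2, ∑ a, ‖S a p.1 (p.1.2, p.2)‖ ^ 2 ≤
      ∑ a, ∑ b, ∑ c, ‖S a b c‖ ^ 2 := by
    rw [Fintype.sum_prod_type]
    -- `Σ_b Σ_ν Σ_a f a b (b.2,ν) ≤ Σ_a Σ_b Σ_c f a b c`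
    calc ∑ b : Fin 2 × Fin 2, ∑ ν : Fin 2, ∑ a, ‖S a b (b.2, ν)‖ ^ 2
        = ∑ a, ∑ b : Fin 2 × Fin 2, ∑ ν : Fin 2, ‖S a b (b.2, ν)‖ ^ 2 := by
          rw [show (∑ b : Fin 2 × Fin 2, ∑ ν : Fin 2, ∑ a : Fin 2 × Fin 2, ‖S a b (b.2, ν)‖ ^ 2)
              = ∑ b : Fin 2 × Fin 2, ∑ a : Fin 2 × Fin 2, ∑ ν : Fin 2, ‖S a b (b.2, ν)‖ ^ 2 from
            Finset.sum_congr rfl fun b _ => Finset.sum_comm]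
          exact Finset.sum_comm
      _ ≤ ∑ a, ∑ b, ∑ c, ‖S a b c‖ ^ 2 := by
          refine Finset.sum_le_sum fun a _ => Finset.sum_le_sum fun b _ => ?_
          rw [Fintype.sum_prod_type (f := fun c : Fin 2 × Fin 2 => ‖S a b c‖ ^ 2)]
          exact Finset.single_le_sum (f := fun m => ∑ ν : Fin 2, ‖S a b (m, ν)‖ ^ 2)
            (fun m _ => by positivity) (Finset.mem_univ b.2)
  calc ‖∑ a, ∑ b, ∑ c, S a b c * matMulTensor ℂ 2 2 2 a b c‖ ^ 2
      = ‖∑ p : (Fin 2 × Fin 2) × Fin 2, S (p.1.1, p.2) p.1 (p.1.2, p.2)‖ ^ 2 := by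
        rw [sixEighthsAtFive_pairing_regroup_bc, Fintype.sum_prod_type (f := fun p : (Fin 2 × Fin 2) × Fin 2 =>
          S (p.1.1, p.2) p.1 (p.1.2, p.2))]
    _ ≤ (∑ p : (Fin 2 × Fin 2) × Fin 2, ‖S (p.1.1, p.2) p.1 (p.1.2, p.2)‖) ^ 2 :=
        pow_le_pow_left₀ (norm_nonneg _) (norm_sum_le _ _) 2
    _ ≤ 6 * ∑ a, ∑ b, ∑ c, ‖S a b c‖ ^ 2 := by
        rw [hW] at hCS
        exact hCS.trans (mul_le_mul_of_nonneg_left hB (by norm_num))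

/-- **`SixEighthsAtFive` on the third-slot hyperplane stratum**: if a non-zero functional annihilates the slot `c`
of `S` (`Σ_c n c S a b c = 0` for all `a, b`), then `|⟨S, ⟨2,2,2⟩⟩|² ≤ 6 ‖S‖²` (any rank). [folklore] -/
theorem sixEighthsAtFive_of_annihilated_c
    (S : (Fin 2 × Fin 2) → (Fin 2 × Fin 2) → (Fin 2 × Fin 2) → ℂ) (n : Fin 2 × Fin 2 → ℂ)
    (hn : n ≠ 0) (hS : ∀ a b, ∑ c, n c * S a b c = 0) :
    ‖∑ a, ∑ b, ∑ c, S a b c * matMulTensor ℂ 2 2 2 a b c‖ ^ 2 ≤ 6 * ∑ a, ∑ b, ∑ c, ‖S a b c‖ ^ 2 := by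
  classical
  have hN : 0 < ∑ b, ‖n b‖ ^ 2 := by
    obtain ⟨b, hb⟩ : ∃ b, n b ≠ 0 := by
      by_contra hcon
      push Not at hcon
      exact hn (funext hcon)
    exact lt_of_lt_of_le (by positivity : (0 : ℝ) < ‖n b‖ ^ 2)
      (Finset.single_le_sum (f := fun b => ‖n b‖ ^ 2) (fun b _ => sq_nonneg _) (Finset.mem_univ b))
  set ρ : Fin 2 × Fin 2 → ℝ := fun b => ‖n b‖ ^ 2 / ∑ b, ‖n b‖ ^ 2 with hρ
  have hρsum : ∑ b, ρ b = 1 := by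
    rw [hρ, ← Finset.sum_div, div_self hN.ne']
  have hρle : ∀ b, ρ b ≤ 1 := fun b => by
    rw [hρ, div_le_one hN]
    exact Finset.single_le_sum (f := fun b => ‖n b‖ ^ 2) (fun b _ => sq_nonneg _) (Finset.mem_univ b)
  have hterm : ∀ (b : Fin 2 × Fin 2) (ν : Fin 2),
      ‖S (b.1, ν) b (b.2, ν)‖ ^ 2 ≤ (1 - ρ (b.2, ν)) * ∑ c, ‖S (b.1, ν) b c‖ ^ 2 :=
    fun b ν => sixEighthsAtFive_annihilated_entry_sq_le' n (fun c => S (b.1, ν) b c) hN (hS (b.1, ν) b) (b.2, ν)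
  have hCS : (∑ p : (Fin 2 × Fin 2) × Fin 2, ‖S (p.1.1, p.2) p.1 (p.1.2, p.2)‖) ^ 2 ≤
      (∑ p : (Fin 2 × Fin 2) × Fin 2, (1 - ρ (p.1.2, p.2))) *
        ∑ p : (Fin 2 × Fin 2) × Fin 2, ∑ c, ‖S (p.1.1, p.2) p.1 c‖ ^ 2 :=
    Finset.sum_sq_le_sum_mul_sum_of_sq_le_mul Finset.univ
      (fun p _ => sub_nonneg.mpr (hρle _)) (fun p _ => by positivity) (fun p _ => hterm p.1 p.2)
  have hW : ∑ p : (Fin 2 × Fin 2) × Fin 2, (1 - ρ (p.1.2, p.2)) = 6 := by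
    have h1 : ∑ b : Fin 2 × Fin 2, ∑ ν : Fin 2, ρ (b.2, ν) = 2 := by
      rw [(sixEighthsAtFive_sum_weight_ac ρ).2, hρsum]; ring
    simp only [Fintype.sum_prod_type, Fin.sum_univ_two, Fin.isValue] at h1 ⊢
    linarith
  have hB : ∑ p : (Fin 2 × Fin 2) × Fin 2, ∑ c, ‖S (p.1.1, p.2) p.1 c‖ ^ 2 ≤
      ∑ a, ∑ b, ∑ c, ‖S a b c‖ ^ 2 := by
    rw [Fintype.sum_prod_type]
    -- `Σ_b Σ_ν Σ_c f (b.1,ν) b c ≤ Σ_a Σ_b Σ_c f a b c = Σ_b Σ_a Σ_c …`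
    calc ∑ b : Fin 2 × Fin 2, ∑ ν : Fin 2, ∑ c, ‖S (b.1, ν) b c‖ ^ 2
        ≤ ∑ b : Fin 2 × Fin 2, ∑ a : Fin 2 × Fin 2, ∑ c, ‖S a b c‖ ^ 2 := by
          refine Finset.sum_le_sum fun b _ => ?_
          rw [Fintype.sum_prod_type (f := fun a : Fin 2 × Fin 2 => ∑ c, ‖S a b c‖ ^ 2)]
          exact Finset.single_le_sum (f := fun κ => ∑ ν : Fin 2, ∑ c, ‖S (κ, ν) b c‖ ^ 2)
            (fun κ _ => by positivity) (Finset.mem_univ b.1)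
      _ = ∑ a, ∑ b, ∑ c, ‖S a b c‖ ^ 2 := Finset.sum_comm
  calc ‖∑ a, ∑ b, ∑ c, S a b c * matMulTensor ℂ 2 2 2 a b c‖ ^ 2
      = ‖∑ p : (Fin 2 × Fin 2) × Fin 2, S (p.1.1, p.2) p.1 (p.1.2, p.2)‖ ^ 2 := by
        rw [sixEighthsAtFive_pairing_regroup_bc, Fintype.sum_prod_type (f := fun p : (Fin 2 × Fin 2) × Fin 2 =>
          S (p.1.1, p.2) p.1 (p.1.2, p.2))]
    _ ≤ (∑ p : (Fin 2 × Fin 2) × Fin 2, ‖S (p.1.1, p.2) p.1 (p.1.2, p.2)‖) ^ 2 :=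
        pow_le_pow_left₀ (norm_nonneg _) (norm_sum_le _ _) 2
    _ ≤ 6 * ∑ a, ∑ b, ∑ c, ‖S a b c‖ ^ 2 := by
        rw [hW] at hCS
        exact hCS.trans (mul_le_mul_of_nonneg_left hB (by norm_num))

/-! ## Sums of triads: factors in a hyperplane; the Bini stratum -/

/-- A sum of triads whose middle factors `u l` all lie in the hyperplane `Σ_b n b · u l b = 0` is annihilated in the
middle slot by `n`. [folklore] -/
theorem sixEighthsAtFive_sum_triad_annihilated_b {r : ℕ} (w u v : Fin r → (Fin 2 × Fin 2) → ℂ) (n : Fin 2 × Fin 2 → ℂ)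
    (hu : ∀ l, ∑ b, n b * u l b = 0) (a c : Fin 2 × Fin 2) :
    ∑ b, n b * (∑ l, triad (w l) (u l) (v l)) a b c = 0 := by
  calc ∑ b, n b * (∑ l, triad (w l) (u l) (v l)) a b c
      = ∑ b, ∑ l, w l a * v l c * (n b * u l b) := by
        refine Finset.sum_congr rfl fun b _ => ?_
        simp only [Finset.sum_apply, triad_apply, Finset.mul_sum]
        exact Finset.sum_congr rfl fun l _ => by ring
    _ = ∑ l, w l a * v l c * ∑ b, n b * u l b := by
        rw [Finset.sum_comm]
        exact Finset.sum_congr rfl fun l _ => by rw [Finset.mul_sum]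
    _ = 0 := by simp [hu]

/-- **`SixEighthsAtFive` for sums of triads with middle factors in a hyperplane** (any number `r` of triads, so in
particular for every tensor of rank `≤ 5` admitting such a decomposition): if `n ≠ 0` and `Σ_b n b · u l b = 0` for all
`l`, then `S = Σ_l w l ⊗ u l ⊗ v l` has `|⟨S, ⟨2,2,2⟩⟩|² ≤ 6 ‖S‖²`. [folklore] -/
theorem sixEighthsAtFive_of_triads_annihilated_b {r : ℕ} (w u v : Fin r → (Fin 2 × Fin 2) → ℂ)
    (n : Fin 2 × Fin 2 → ℂ) (hn : n ≠ 0) (hu : ∀ l, ∑ b, n b * u l b = 0) :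
    ‖∑ a, ∑ b, ∑ c, (∑ l, triad (w l) (u l) (v l)) a b c * matMulTensor ℂ 2 2 2 a b c‖ ^ 2 ≤
      6 * ∑ a, ∑ b, ∑ c, ‖(∑ l, triad (w l) (u l) (v l)) a b c‖ ^ 2 :=
  sixEighthsAtFive_of_annihilated_b _ n hn (sixEighthsAtFive_sum_triad_annihilated_b w u v n hu)

/-- **`SixEighthsAtFive` on the Bini stratum.** If all middle factors of a sum of triads have a vanishing `(i,j)`
entry (`u l (i,j) = 0` for all `l`; Bini's honest rank-5 family `m·M^red + C₂`, Landsberg 2017 (2.1.2), is the case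
`(i,j) = (1,1)`: its `x`-factors are `m x₁₂ + x₁₁, m x₂₁ + x₁₁, −m x₁₂, −m x₂₁, x₁₂ + x₂₁`), then
`|⟨S, ⟨2,2,2⟩⟩|² ≤ 6 ‖S‖²` — the item's inequality on the whole family along which its bound `6` is approached.
[cite: Landsberg2017, (2.1.2)] -/
theorem sixEighthsAtFive_biniStratum {r : ℕ} (w u v : Fin r → (Fin 2 × Fin 2) → ℂ) (i j : Fin 2)
    (hu : ∀ l, u l (i, j) = 0) :
    ‖∑ a, ∑ b, ∑ c, (∑ l, triad (w l) (u l) (v l)) a b c * matMulTensor ℂ 2 2 2 a b c‖ ^ 2 ≤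
      6 * ∑ a, ∑ b, ∑ c, ‖(∑ l, triad (w l) (u l) (v l)) a b c‖ ^ 2 := by
  classical
  refine sixEighthsAtFive_of_triads_annihilated_b w u v (fun b => if b = (i, j) then 1 else 0) ?_ ?_
  · intro h
    have := congr_fun h (i, j)
    simp at this
  · intro l
    rw [Finset.sum_eq_single (i, j)]
    · simp [hu l]
    · intro b _ hb
      simp [hb]
    · intro h
      exact absurd (Finset.mem_univ _) h

end Summit.MatrixMultiplication.MatrixMultiplication.Theorems
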